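import Mathlib.Algebra.Homology.Additive
import Mathlib.CategoryTheory.Sites.Abelian
import Literature.AlgebraicGeometry.Crystalline.DeRhamComplexPresheaf
import HarnessLib

/-!
# The algebraic de Rham complex of sheaves `Ω•_{X/k}`

Sheafification of the presheaf of de Rham complexes of `Crystalline/DeRhamComplexPresheaf`.

For a morphism `φ : S ⟶ R` of presheaves of commutative rings on a site `(D, J)`:
* `deRhamComplexSheaf J φ : CochainComplex (Sheaf J Ab) ℕ` — the term-wise sheafification
  (Mathlib's `presheafToSheaf`, an additive functor, applied through
  `Functor.mapHomologicalComplex`) of `deRhamComplexPresheaf φ`; its degree-`1` and degree-`0` terms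
  are the sheafifications of `Ω¹` (`XOneIso`) and of the structure presheaf `R` (`XZeroIso`).

For a `k`-scheme `X : Over (Spec k)` (structure morphism `Motives.constToPresheaf X`):
* `algebraicDeRhamComplex X : CochainComplex (Sheaf (Opens.grothendieckTopology X) Ab) ℕ`, **the
  algebraic de Rham complex `Ω•_{X/k}`** of sheaves of abelian groups (`k`-vector spaces on paper);
  its terms in degrees `1` and `0` are (the abelian sheaves underlying) the tree's cotangent sheaf
  `Motives.cotangentSheaf X` (`algebraicDeRhamComplexXOneIso`, definitionally on the nose thanks to
  Mathlib's `PresheafOfModules.sheafificationCompToSheaf = Iso.refl`) and the structure sheaf `𝒪_X`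
  (`algebraicDeRhamComplexXZeroIso`); hence `Hᵠ(X, Ω¹) = Motives.hodgeCohomologyOne X q`
  (`hOneAddEquiv`) and `Hᵠ(X, Ω⁰) = Motives.structureSheafCohomology X q` (`hZeroAddEquiv`).

Sources: A. Grothendieck, *On the de Rham cohomology of algebraic varieties*, Publ. IHÉS 29 (1966);
EGA IV₄ 16.6; R. Hartshorne, *Algebraic Geometry* (1977), III.7 p. 225; The Stacks project,
Tag 0FKL. [folklore]
Everything is proved; no named facts. NOT here: the identification of the degree-`a` term with the
tree's `Motives.hodgeSheaf X a = ⋀ᵃ(cotangentSheaf)` for `a ≥ 2` (sheafifying inside the exterior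
power; needs "`⋀ᵃ` preserves local isomorphisms", i.e. stalks), the `ℤ`-indexed extension and
hypercohomology `ℍ•(X, Ω•)` (`Crystalline/SheafHypercohomology`), the Hodge filtration / truncations
`Ω^{≥ r}`, reductions modulo `pᴺ` (definition item `defn-PadicDeRhamComplex`, parts (2)–(3)).
-/

noncomputable section

namespace Literature.AlgebraicGeometry.Crystalline

open CategoryTheory Literature.AlgebraicGeometry.Motives DeRhamComplexPresheaf

universe v₁ u₁ u

/-! ### On a site -/

section Site

variable {D : Type u₁} [Category.{v₁} D] (J : GrothendieckTopology D)
  [HasSheafify J AddCommGrpCat.{u}] {S R : Dᵒᵖ ⥤ CommRingCat.{u}} (φ : S ⟶ R)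

/-- The **de Rham complex of sheaves** of `φ : S ⟶ R` on the site `(D, J)`: the term-wise
sheafification of the presheaf of de Rham complexes `U ↦ (⋀•_{R(U)} Ω[R(U)⁄S(U)], d)`.
(Stacks 0FKL; EGA IV₄ 16.6.) [folklore] -/
def deRhamComplexSheaf : CochainComplex (Sheaf J AddCommGrpCat.{u}) ℕ :=
  ((presheafToSheaf J AddCommGrpCat.{u}).mapHomologicalComplex _).obj (deRhamComplexPresheaf φ)

/-- The `n`-th term of the de Rham complex of sheaves is the sheaf of `n`-forms (the sheafification
of the presheaf of `n`-forms). [folklore] -/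
theorem deRhamComplexSheaf_X (n : ℕ) :
    (deRhamComplexSheaf J φ).X n = (presheafToSheaf J AddCommGrpCat.{u}).obj (formsPresheaf φ n) :=
  rfl

/-- The differential of the de Rham complex of sheaves is the sheafified exterior derivative.
[folklore] -/
theorem deRhamComplexSheaf_d (n : ℕ) :
    (deRhamComplexSheaf J φ).d n (n + 1) =
      (presheafToSheaf J AddCommGrpCat.{u}).map (deRhamDifferential φ n) := by
  change (presheafToSheaf J AddCommGrpCat.{u}).map ((deRhamComplexPresheaf φ).d n (n + 1)) = _
  rw [deRhamComplexPresheaf_d]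
  rfl

/-- The degree-`1` term is the sheafification of the presheaf `Ω¹` of Kähler differentials
(through `⋀¹ Ω¹ ≅ Ω¹`, the tree's `exteriorPowerPresheafOneIso`). [folklore] -/
def XOneIso : (deRhamComplexSheaf J φ).X 1 ≅ (presheafToSheaf J AddCommGrpCat.{u}).obj
    (PresheafOfModules.DifferentialsConstruction.relativeDifferentials' φ).presheaf :=
  (presheafToSheaf J AddCommGrpCat.{u}).mapIso
    ((PresheafOfModules.toPresheaf _).mapIso (exteriorPowerPresheafOneIso _))

/-- The degree-`0` term is the sheafification of the structure presheaf `R` (through `⋀⁰ Ω¹ ≅ R`,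
the tree's `exteriorPowerPresheafZeroIso`). [folklore] -/
def XZeroIso : (deRhamComplexSheaf J φ).X 0 ≅ (presheafToSheaf J AddCommGrpCat.{u}).obj
    (PresheafOfModules.unit (R ⋙ forget₂ _ _)).presheaf :=
  (presheafToSheaf J AddCommGrpCat.{u}).mapIso
    ((PresheafOfModules.toPresheaf _).mapIso (exteriorPowerPresheafZeroIso _))

end Site

/-! ### Transport of sheaf cohomology along an isomorphism -/

section Transport

variable {C : Type u₁} [Category.{v₁} C] {J : GrothendieckTopology C}
  [HasSheafify J AddCommGrpCat.{u}] [HasExt.{u} (Sheaf J AddCommGrpCat.{u})]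

/-- An isomorphism of abelian sheaves induces `Hⁿ(F) ≃+ Hⁿ(G)` (Mathlib's `Sheaf.H.map` both ways;
the same term as the tree's `Motives.sheafHAddEquivOfIso`, kept local to stay low in the import
graph). [folklore] -/
def hTransport {F G : Sheaf J AddCommGrpCat.{u}} (e : F ≅ G) (n : ℕ) : F.H n ≃+ G.H n where
  toFun := Sheaf.H.map e.hom n
  invFun := Sheaf.H.map e.inv n
  left_inv x := by rw [← Sheaf.H.map_comp_apply, e.hom_inv_id, Sheaf.H.map_id_apply]
  right_inv x := by rw [← Sheaf.H.map_comp_apply, e.inv_hom_id, Sheaf.H.map_id_apply]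
  map_add' := map_add _

/-- `hTransport e n` is `Hⁿ(e.hom)` on elements. [folklore] -/
theorem hTransport_apply {F G : Sheaf J AddCommGrpCat.{u}} (e : F ≅ G) (n : ℕ) (x : F.H n) :
    hTransport e n x = Sheaf.H.map e.hom n x := rfl

end Transport

/-! ### The algebraic de Rham complex of a `k`-scheme -/

section Scheme

open _root_.AlgebraicGeometry _root_.TopologicalSpace

variable {k : Type u} [CommRing k] (X : Over (Spec (CommRingCat.of k)))

/-- **The algebraic de Rham complex `Ω•_{X/k}`** of a `k`-scheme `X`: the complex of sheaves of
abelian groups `𝒪_X →ᵈ Ω¹_{X/k} →ᵈ Ω²_{X/k} →ᵈ ⋯` on `X`, the sheafification of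
`U ↦ (⋀•_{Γ(X,U)} Ω[Γ(X,U)⁄k], d)` for the structure morphism `k → 𝒪_X` (the tree's
`Motives.constToPresheaf X`). Its hypercohomology is the algebraic de Rham cohomology of `X/k`.
(Grothendieck 1966; EGA IV₄ 16.6; Hartshorne III.7 p. 225; Stacks 0FKL.) [folklore] -/
def algebraicDeRhamComplex :
    CochainComplex (Sheaf (Opens.grothendieckTopology X.left) AddCommGrpCat.{u}) ℕ :=
  deRhamComplexSheaf (Opens.grothendieckTopology X.left) (constToPresheaf X)

/-- The presheaf of `n`-forms of the structure morphism of `X` is the `n`-th exterior power of the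
tree's presheaf of Kähler differentials `Motives.kaehlerPresheaf X` (definitionally). [folklore] -/
theorem formsPresheafOfModules_constToPresheaf (n : ℕ) :
    formsPresheafOfModules (constToPresheaf X) n = exteriorPowerPresheaf (kaehlerPresheaf X) n :=
  rfl

/-- **`Ω¹_{X/k}` in the de Rham complex is the cotangent sheaf**: the degree-`1` term of
`algebraicDeRhamComplex X` is (the abelian sheaf underlying) the tree's `Motives.cotangentSheaf X`.
[folklore] -/
def algebraicDeRhamComplexXOneIso :
    (algebraicDeRhamComplex X).X 1 ≅
      (SheafOfModules.toSheaf X.left.ringCatSheaf).obj (cotangentSheaf X) :=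
  XOneIso _ (constToPresheaf X)

/-- **`Ω⁰_{X/k} = 𝒪_X`**: the degree-`0` term of `algebraicDeRhamComplex X` is (the abelian sheaf
underlying) the structure sheaf, i.e. the free rank-one module `SheafOfModules.unit`. [folklore] -/
def algebraicDeRhamComplexXZeroIso :
    (algebraicDeRhamComplex X).X 0 ≅
      (SheafOfModules.toSheaf X.left.ringCatSheaf).obj (SheafOfModules.unit X.left.ringCatSheaf) :=
  XZeroIso _ (constToPresheaf X) ≪≫
    (sheafificationIso ((SheafOfModules.toSheaf X.left.ringCatSheaf).obj
      (SheafOfModules.unit X.left.ringCatSheaf))).symm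

/-- `Hᵠ(X, Ω¹_{X/k})` computed in the de Rham complex is the tree's `Motives.hodgeCohomologyOne X q`.
[folklore] -/
def hOneAddEquiv (q : ℕ) : ((algebraicDeRhamComplex X).X 1).H q ≃+ hodgeCohomologyOne X q :=
  hTransport (algebraicDeRhamComplexXOneIso X) q

/-- `Hᵠ(X, Ω⁰_{X/k}) = Hᵠ(X, 𝒪_X)` is the tree's `Motives.structureSheafCohomology X q`. [folklore] -/
def hZeroAddEquiv (q : ℕ) :
    ((algebraicDeRhamComplex X).X 0).H q ≃+ structureSheafCohomology X.left q :=
  hTransport (algebraicDeRhamComplexXZeroIso X) q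

end Scheme

end Literature.AlgebraicGeometry.Crystalline

end
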